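import Summits.CriticalPhenomena.CardyFormulaZ2.Theorems.CardyIKTransportIKMixedBoxCrossingDefectStubBridgeOfLaw

/-!
# Stub `stub_freeLocality` of the line `defect-closure-exploration` (crux `IKMixedBoxCrossing`, stmt-CriticalPhenomena-5911)

FREE-MODEL LOCALITY: if every interior face column of the `W × H` box at `(a, b)` is an `S`-column
(`∀ x, a ≤ x → x + 1 < a + W → x ∈ S`), the finite free mixed model of the box and its crossing events ARE those
of the isotropic pattern `S = univ`, so `hfree S = hfree univ` and `vfree S = vfree univ` there.

* MEASURE (`facesIn_eq`, `boxLaw_eq`): an inner face `v` of the rectangle has `v` and `v + e₀` in the rectangle, so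
  `a ≤ v 0` and `v 0 + 1 < a + W`, hence `v 0 ∈ S`: the interaction sets `facesIn S Λ = facesIn univ Λ` agree, and
  so do `colourLaw` / `boxLaw`.
* EVENT (`cross_congr`, `lrEvent_eq_univ`, `tbEvent_eq_univ`): membership in `openCrossing X A B` only reads edges
  with both ends in the box (`mem_openCrossing_congr`); such an edge reads the anti flag of the face `u` (clause
  `v = u + (1,1)`) or `u + (0,-1)` (clause `v = u + (1,-1)`), whose column `u 0` satisfies `a ≤ u 0` and
  `u 0 + 1 = v 0 < a + W`, so the face column lies in `S` and `antiFaces S`, `antiFaces univ` agree on it.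
-/

noncomputable section

namespace Summit.CriticalPhenomena.CardyFormulaZ2.Cruxes.IKMixedBoxCrossing.DefectClosureExploration

open scoped Classical
open MeasureTheory
open Literature.Probability.Percolation Literature.Probability.LatticeModels
open Summit.CriticalPhenomena.CardyFormulaZ2.Theorems.IKLinearTransport.PinnedDiagramExchange
  (Obs blackEdges lrCross tbCross)
open Summit.CriticalPhenomena.CardyFormulaZ2.Theorems.IKLinearTransport.PinnedDiagramExchange.CouplingToLimits
  (mk_mem_blackEdges_iff)
open Summit.CriticalPhenomena.CardyFormulaZ2.Cruxes.IKMixedBoxCrossing.PairedMirrorExploration.StubPatternLocality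
  (mem_openCrossing_congr)
open BridgeOfLawStub (toObs lrEvent_eq tbEvent_eq mem_cellRect)

namespace FreeLocalityStub

variable {S : Set ℤ} {a b : ℤ} {W H : ℕ}

/-! ## §1 The measure: same interaction faces -/

/-- Under the interior-column hypothesis the interaction faces of the box are those of the isotropic pattern. -/
theorem facesIn_eq (hS : ∀ x : ℤ, a ≤ x → x + 1 < a + W → x ∈ S) :
    facesIn S (cellRect a b W H) = facesIn Set.univ (cellRect a b W H) := by
  ext v
  simp only [facesIn, Finset.mem_filter, Set.mem_univ, and_true, mem_innerVertices_iff]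
  refine ⟨fun h => h.1, fun hv => ⟨hv, ?_⟩⟩
  have h1 := mem_cellRect.1 (hv (self_mem_cellFace v))
  have h2 := mem_cellRect.1 (hv (mem_cellFace_iff.2 (Or.inr (Or.inl rfl))))
  simp only [Pi.add_apply, Pi.single_eq_same] at h2
  exact hS (v 0) h1.1 h2.2.1

/-- The free law of the box is that of the isotropic pattern. -/
theorem boxLaw_eq (hS : ∀ x : ℤ, a ≤ x → x + 1 < a + W → x ∈ S) :
    boxLaw S (cellRect a b W H) = boxLaw Set.univ (cellRect a b W H) := by
  rw [boxLaw, boxLaw, colourLaw, colourLaw, facesIn_eq hS]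

/-! ## §2 The events: same diagonals inside the box -/

/-- The anti flag of a face in an interior column does not see the pattern. -/
theorem mem_antiFaces_congr (hS : ∀ x : ℤ, a ≤ x → x + 1 < a + W → x ∈ S) {κ : Site 2 → Bool} {f : Site 2}
    (h1 : a ≤ f 0) (h2 : f 0 + 1 < a + W) : f ∈ antiFaces S κ ↔ f ∈ antiFaces Set.univ κ := by
  simp only [antiFaces, Set.mem_setOf_eq, Set.mem_univ, not_true_eq_false, false_or]
  exact or_iff_right fun h => h (hS _ h1 h2)

/-- One orientation of an edge with both ends in the box: observables with the same black cells and the same anti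
flags on the interior face columns read it alike. -/
theorem clause_congr {x y : Obs} (h1 : x.1 = y.1)
    (h2 : ∀ f : Site 2, a ≤ f 0 → f 0 + 1 < a + W → (f ∈ x.2 ↔ f ∈ y.2)) {p q : Site 2}
    (hp : p ∈ {v : Site 2 | a ≤ v 0 ∧ v 0 < a + W ∧ b ≤ v 1 ∧ v 1 < b + H})
    (hq : q ∈ {v : Site 2 | a ≤ v 0 ∧ v 0 < a + W ∧ b ≤ v 1 ∧ v 1 < b + H}) :
    (p ∈ x.1 ∧ q ∈ x.1 ∧ (q = p + ![1, 0] ∨ q = p + ![0, 1] ∨ (q = p + ![1, 1] ∧ ¬ p ∈ x.2) ∨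
        (q = p + ![1, -1] ∧ (p + ![0, -1]) ∈ x.2))) ↔
      (p ∈ y.1 ∧ q ∈ y.1 ∧ (q = p + ![1, 0] ∨ q = p + ![0, 1] ∨ (q = p + ![1, 1] ∧ ¬ p ∈ y.2) ∨
        (q = p + ![1, -1] ∧ (p + ![0, -1]) ∈ y.2))) := by
  simp only [Set.mem_setOf_eq] at hp hq
  have hd1 : q = p + ![1, 1] → (p ∈ x.2 ↔ p ∈ y.2) := fun hqp => by
    subst hqp
    simp only [Pi.add_apply, Matrix.cons_val_zero, Matrix.cons_val_one] at hq
    exact h2 p hp.1 hq.2.1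
  have hd2 : q = p + ![1, -1] → ((p + ![0, -1]) ∈ x.2 ↔ (p + ![0, -1]) ∈ y.2) := fun hqp => by
    subst hqp
    simp only [Pi.add_apply, Matrix.cons_val_zero, Matrix.cons_val_one] at hq
    refine h2 _ ?_ ?_ <;> simp only [Pi.add_apply, Matrix.cons_val_zero] <;> omega
  rw [h1]
  exact and_congr_right' (and_congr_right' (or_congr_right (or_congr_right (or_congr
    (and_congr_right fun h => not_congr (hd1 h)) (and_congr_right hd2)))))

/-- INTERIOR-COLUMN LOCALITY of the crossing events: observables with the same black cells and the same anti flags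
on the interior face columns `[a, a+W-1)` have the same crossings of the box `[a, a+W) × [b, b+H)`. -/
theorem cross_congr {x y : Obs} (h1 : x.1 = y.1)
    (h2 : ∀ f : Site 2, a ≤ f 0 → f 0 + 1 < a + W → (f ∈ x.2 ↔ f ∈ y.2)) :
    (x ∈ lrCross a b W H ↔ y ∈ lrCross a b W H) ∧ (x ∈ tbCross a b W H ↔ y ∈ tbCross a b W H) := by
  have key : ∀ u ∈ {v : Site 2 | a ≤ v 0 ∧ v 0 < a + W ∧ b ≤ v 1 ∧ v 1 < b + H},
      ∀ v ∈ {v : Site 2 | a ≤ v 0 ∧ v 0 < a + W ∧ b ≤ v 1 ∧ v 1 < b + H},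
        (s(u, v) ∈ blackEdges x ↔ s(u, v) ∈ blackEdges y) := fun u hu v hv => by
    rw [mk_mem_blackEdges_iff, mk_mem_blackEdges_iff]
    exact or_congr (clause_congr (H := H) h1 h2 hu hv) (clause_congr (H := H) h1 h2 hv hu)
  exact ⟨mem_openCrossing_congr key, mem_openCrossing_congr key⟩

/-- The free-model observables for `S` and for `univ` have the same crossings of the box. -/
theorem toObs_cross_congr (hS : ∀ x : ℤ, a ≤ x → x + 1 < a + W → x ∈ S) (x : CellConfig) :
    (toObs S x ∈ lrCross a b W H ↔ toObs Set.univ x ∈ lrCross a b W H) ∧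
      (toObs S x ∈ tbCross a b W H ↔ toObs Set.univ x ∈ tbCross a b W H) :=
  cross_congr rfl fun _ hf1 hf2 => mem_antiFaces_congr hS hf1 hf2

/-- The free LR event of the box is that of the isotropic pattern. -/
theorem lrEvent_eq_univ (hS : ∀ x : ℤ, a ≤ x → x + 1 < a + W → x ∈ S) :
    lrEvent S a b W H = lrEvent Set.univ a b W H := by
  rw [lrEvent_eq, lrEvent_eq]
  exact Set.ext fun x => (toObs_cross_congr (b := b) (H := H) hS x).1

/-- The free TB event of the box is that of the isotropic pattern. -/
theorem tbEvent_eq_univ (hS : ∀ x : ℤ, a ≤ x → x + 1 < a + W → x ∈ S) :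
    tbEvent S a b W H = tbEvent Set.univ a b W H := by
  rw [tbEvent_eq, tbEvent_eq]
  exact Set.ext fun x => (toObs_cross_congr (b := b) (H := H) hS x).2

end FreeLocalityStub

open FreeLocalityStub in
/-- **Registered stub `stub_freeLocality`** (line `defect-closure-exploration`): if every interior face column of
the `W × H` box is an `S`-column, the free mixed model of the box (same interaction faces) and its crossing events
(same diagonals inside the box) are those of the isotropic pattern, so `hfree S = hfree univ` and
`vfree S = vfree univ` there. -/
theorem stub_freeLocality : FreeLocality := by
  intro S a b W H hS
  unfold hfree vfree
  rw [boxLaw_eq hS, lrEvent_eq_univ hS, tbEvent_eq_univ hS]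
  exact ⟨rfl, rfl⟩

end Summit.CriticalPhenomena.CardyFormulaZ2.Cruxes.IKMixedBoxCrossing.DefectClosureExploration

end
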